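import Literature.Analysis.FluidPDE.FluidComputer.TubeTable
import HarnessLib

/-!
# Kernel run of the tube checker, chunks 12 … 17 (steps 600 … 899) (bp3 gen 13)

HONEST FRAMING: low prior, high value-of-information experiment on Tao's machine paradigm; NOT a
claim that NS blows up.

Kernel evaluations (`decide +kernel`; no `native_decide`, no extra axioms) of the tube checker
`runTube` of `TubeCheck.lean` (dyadic interval arithmetic `DI` at `P = 60`, `12` Taylor terms,
cube radius `Rt`, read-out level `CLt`) on the chunks `cT 12 … cT 17` of the schedule of
`TubeTable.lean`, each from the recorded boundary state `sT i` to `sT (i+1)` (≈ 0.6 s of kernel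
time per step).
-/

namespace Literature.Analysis.FluidPDE.FluidComputer

namespace TubeTable

open ThresholdLevelTable

set_option maxHeartbeats 10000000 in
set_option maxRecDepth 200000 in
/-- Chunk 12 of the tube run (steps 600 … 649, `h = 2^-11`). [folklore] -/
theorem run_12 : runTube 60 12 GIt CLt Rt (sT 12) (cT 12) = some (sT (12 + 1)) := by
  decide +kernel

set_option maxHeartbeats 10000000 in
set_option maxRecDepth 200000 in
/-- Chunk 13 of the tube run (steps 650 … 699, `h = 2^-11`). [folklore] -/
theorem run_13 : runTube 60 12 GIt CLt Rt (sT 13) (cT 13) = some (sT (13 + 1)) := by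
  decide +kernel

set_option maxHeartbeats 10000000 in
set_option maxRecDepth 200000 in
/-- Chunk 14 of the tube run (steps 700 … 749, `h = 2^-11`). [folklore] -/
theorem run_14 : runTube 60 12 GIt CLt Rt (sT 14) (cT 14) = some (sT (14 + 1)) := by
  decide +kernel

set_option maxHeartbeats 10000000 in
set_option maxRecDepth 200000 in
/-- Chunk 15 of the tube run (steps 750 … 799, `h = 2^-11`). [folklore] -/
theorem run_15 : runTube 60 12 GIt CLt Rt (sT 15) (cT 15) = some (sT (15 + 1)) := by
  decide +kernel

set_option maxHeartbeats 10000000 in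
set_option maxRecDepth 200000 in
/-- Chunk 16 of the tube run (steps 800 … 849, `h = 2^-11`). [folklore] -/
theorem run_16 : runTube 60 12 GIt CLt Rt (sT 16) (cT 16) = some (sT (16 + 1)) := by
  decide +kernel

set_option maxHeartbeats 10000000 in
set_option maxRecDepth 200000 in
/-- Chunk 17 of the tube run (steps 850 … 899, `h = 2^-11`). [folklore] -/
theorem run_17 : runTube 60 12 GIt CLt Rt (sT 17) (cT 17) = some (sT (17 + 1)) := by
  decide +kernel

end TubeTable

end Literature.Analysis.FluidPDE.FluidComputer
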